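/-
Copyright: harness tree, Literature layer (sorry-free). b2b-lace enum1-g53 (ENUMERATION SHARD A gen 53),
node KU-SEP-SEED-K2 (product rows at the axis nodes `|m| ≥ 2`): the FAR-SEED form of the truncation-error
bound of a PRODUCT-row twisted seed certificate — the product twin of `SrwTwistSeedCertRowBoundFar`.
d-generic; number-free; what-if / input-certification lane device; no statement at any fixed dimension.
-/
import Literature.Probability.FitznerVanDerHofstad2017.SrwTwistProdCertRowBound
import Literature.Probability.FitznerVanDerHofstad2017.SrwTwistSeedCertRowBoundFar
import HarnessLib

/-!
# Product-row twisted SEEDCERT: the truncation error `truncErrP` with the error seeds placed far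

`PrCert.truncErrP c D n β M` (module `SrwTwistProdCertRow`) is the row-truncation / coefficient-rounding error
of the product cosine-power twisted seed `Tw^{Π_μ cos^{a_μ}}_{n+1}(m e_i; β)`:
`Σ_{k<D} C(D,k+1) (2δ_J)^{k+1} I_{n+1,0}(((J+1)M − a_max)·(e_0+…+e_k)) + ((α'+η)^D − α'^D)/(2π)^D · I_{n+1,0}(0)`,
`δ_J = Σ_{l≥0} |J_{l+J+1}(β/D)|` — the single-row error `TwCert.truncErrT` with the ball radius `(J+1)M` replaced
by `(J+1)M − a_max` (`a_max` = the largest cosine exponent of the class list: the class coordinates carry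
EXACT finite cosine-power rows, only the twisted coordinate is truncated at Bessel order `J`, so the dropped
lattice support starts at distance `(J+1)M − a_max`).  Its consumers so far (`PrCert.truncErrP_le(_cast)`,
`PrCert.srwTwistProdCosPow_mem_of_checkP_of_lit(_perm)`, module `SrwTwistProdCertRowBound`) go through
`truncErrP_le_truncErrT_zero`, i.e. place EVERY error seed at the origin — sharp enough at `m = 1` with the
full column truncation order `J` (`δ_J(β/D)` tiny), but at the axis nodes `|m| ≥ 2` a SHORT row (small `J`,
Bessel orders `j·m + a` inside the kernel's range) makes `δ_J` visible and the origin seed `I_{n+1,0}(0)` then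
costs orders of magnitude.  This file proves the genuine far-seed form with TWO seed scalars, exactly as
`SrwTwistSeedCertRowBoundFar` does for the axis rows:

* **`PrCert.truncErrP_le_far`** — for `2(n+1)+1 ≤ D`, `0 < qden`: if `δ_J(β/D) ≤ δ̄`, every literal weight is
  within `e` of `J_j(β/D)` (`j ≤ J`), the AXIS error seed satisfies `I_{n+1,0}(((J+1)M − a_max)·e_0) ≤ I_far` and
  `I_{n+1,0}(0) ≤ I₀`, then `truncErrP c D n β M ≤ ((1+2δ̄)^D − 1)·I_far + ((A + (2J+1)e)^D − A^D)·I₀`,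
  `A = absMassQ c.toTwCert` (every error seed is dominated by the axis one, `TwCert.srwI_errSeed_le_axis`;
  a tabulated axis value at any `R' ≤ (J+1)M − a_max` serves as `I_far` by `TwCert.srwI_axisSeed_anti`);
* **`PrCert.truncErrP_le_far_cast`** — `truncErrP ≤ ((TwCert.truncErrFarQ c.toTwCert D δ̄ e I_far I₀ : ℚ) : ℝ)`
  for rational inputs (the rational bookkeeping function of `SrwTwistSeedCertRowBoundFar`), the shape a
  kernel-decided consumer inequality uses;
* **`PrCert.srwTwistProdCosPow_mem_of_checkP_far`** and the ORDER-FREE **`PrCert.srwTwistProdCosPow_mem_of_checkP_far_perm`**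
  — the certified brackets of `SrwTwistProdCertRow` / `SrwTwistProdCertRowBound` with the error replaced by
  `truncErrFarQ` of the four rational scalars, at the row-budget point `M := c.m`
  (`c.amax ≤ (c.J+1)·c.m`, far seed at `((c.J+1)·c.m − c.amax)·e_0`).

Everything is PROVED (standard axioms), generic in the dimension and number-free; no definition, no instance,
no named fact. Epistemic status / lane: what-if / input-certification SUPPORT; nothing here is a certificate;
no statement at a specific dimension.

## References
* R. Fitzner, R. van der Hofstad, *Generalized approach to the non-backtracking lace expansion*,
  PTRF 169 (2017) 1041–1119 (arXiv:1506.07969), (3.34)–(3.38) p. 1071, §5.1.1 (5.2)–(5.5) pp. 1089–1090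
  (the Bessel-row evaluation of the SRW integrals of the notebook `SRW.nb` §1). [FitznerVanDerHofstad2016NoBLE]
* T. Hara, G. Slade, *The lace expansion for self-avoiding walk in five or more dimensions*, Rev. Math.
  Phys. 4 (1992) 235–327, App. B Lemma B.3 (monotonicity of `I_{n,0}` in `|x_μ|`). [HaraSlade1992b]
[cite: FitznerVanDerHofstad2016NoBLE, §5.1.1 (5.2)–(5.5) pp. 1089–1090]
-/

set_option Elab.async false

namespace Literature.Probability.FitznerVanDerHofstad2017.SeedCert

open Real MeasureTheory Set Finset
open Literature.Probability.LatticeModels (besselI)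
open Literature.Analysis.FunctionSpaces (besselJ)
open scoped Nat

namespace PrCert

variable (c : PrCert) (D : ℕ)

/-- **`truncErrP` from four scalars, far-seed form.** For `2(n+1)+1 ≤ D`, `0 < qden`: if the Bessel-`J` order
tail is `≤ δ̄`, every literal weight is within `e` of `J_j(β/D)` (`j ≤ J`), the AXIS error seed satisfies
`I_{n+1,0}(((J+1)M − a_max)·e_0) ≤ I_far` and `I_{n+1,0}(0) ≤ I₀`, then
`truncErrP c D n β M ≤ ((1+2δ̄)^D − 1)·I_far + ((A + (2J+1)e)^D − A^D)·I₀`, `A = absMassQ c.toTwCert`.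
[cite: FitznerVanDerHofstad2016NoBLE, §5.1.1 (5.2)–(5.5) pp. 1089–1090] -/
theorem truncErrP_le_far (n : ℕ) (hD : 2 * (n + 1) + 1 ≤ D) (hq : 0 < c.qden) (β : ℝ) (M : ℕ)
    {δb e Ifar I0 : ℝ}
    (hδ : ∑' l : ℕ, |besselJ (l + c.J + 1) (β / D)| ≤ δb)
    (he : ∀ j ∈ Finset.range (c.J + 1), |((c.Q j : ℤ) : ℝ) / (c.qden : ℝ) - besselJ j (β / D)| ≤ e)
    (hIfar : srwI D (n + 1) 0
        (fun μ : Fin D => if (μ : ℕ) < 1 then ((((c.J + 1) * M - c.amax : ℕ)) : ℤ) else 0) ≤ Ifar)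
    (hI0 : srwI D (n + 1) 0 (fun _ : Fin D => 0) ≤ I0) :
    c.truncErrP D n β M
      ≤ ((1 + 2 * δb) ^ D - 1) * Ifar
          + ((((c.toTwCert.absMassQ : ℚ) : ℝ) + (2 * c.J + 1) * e) ^ D
              - ((c.toTwCert.absMassQ : ℚ) : ℝ) ^ D) * I0 := by
  -- names
  set δ : ℝ := ∑' l : ℕ, |besselJ (l + c.J + 1) (β / D)| with hδdef
  set I₀ : ℝ := srwI D (n + 1) 0 (fun _ : Fin D => 0) with hI₀def
  set A : ℝ := ((c.toTwCert.absMassQ : ℚ) : ℝ) with hAdef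
  set η : ℝ := ∑ j ∈ Finset.range (c.J + 1), (if j = 0 then (1 : ℝ) else 2)
      * ‖2 * π * Complex.I ^ j * (besselJ j (β / D) : ℂ) - c.toTwCert.cT j‖ with hηdef
  have hδ0 : 0 ≤ δ := tsum_nonneg fun _ => abs_nonneg _
  have hδb0 : 0 ≤ δb := hδ0.trans hδ
  have hI₀0 : 0 ≤ I₀ := srwI_nonneg (d := D) (n + 1) hD 0 _
  have hI00 : 0 ≤ I0 := hI₀0.trans hI0
  have hIfar0 : 0 ≤ Ifar := (srwI_nonneg (d := D) (n + 1) hD 0 _).trans hIfar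
  have hA0 : 0 ≤ A := by rw [hAdef]; exact_mod_cast c.toTwCert.absMassQ_nonneg
  have he0 : 0 ≤ e := (abs_nonneg _).trans (he 0 (by simp))
  have hw : ∀ j : ℕ, (0 : ℝ) ≤ (if j = 0 then (1 : ℝ) else 2) := fun j => by split_ifs <;> norm_num
  have hη0 : 0 ≤ η := Finset.sum_nonneg fun j _ => mul_nonneg (hw j) (norm_nonneg _)
  have h2π : (0 : ℝ) < 2 * π := by positivity
  -- every error seed is below the axis one at the same radius, hence below `Ifar`
  have hIk : ∀ k ∈ Finset.range D, srwI D (n + 1) 0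
      (fun μ : Fin D => if (μ : ℕ) < k + 1 then ((((c.J + 1) * M - c.amax : ℕ)) : ℤ) else 0) ≤ Ifar :=
    fun k _ => (TwCert.srwI_errSeed_le_axis D n hD ((c.J + 1) * M - c.amax) k).trans hIfar
  -- the first term
  have hT1 : (∑ k ∈ Finset.range D, (D.choose (k + 1) : ℝ) * (2 * δ) ^ (k + 1)
      * srwI D (n + 1) 0
          (fun μ : Fin D => if (μ : ℕ) < k + 1 then ((((c.J + 1) * M - c.amax : ℕ)) : ℤ) else 0))
      ≤ ((1 + 2 * δb) ^ D - 1) * Ifar := by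
    calc (∑ k ∈ Finset.range D, (D.choose (k + 1) : ℝ) * (2 * δ) ^ (k + 1)
          * srwI D (n + 1) 0
            (fun μ : Fin D => if (μ : ℕ) < k + 1 then ((((c.J + 1) * M - c.amax : ℕ)) : ℤ) else 0))
        ≤ ∑ k ∈ Finset.range D, (D.choose (k + 1) : ℝ) * (2 * δb) ^ (k + 1) * Ifar := by
          refine Finset.sum_le_sum fun k hk => ?_
          have h1 : (2 * δ) ^ (k + 1) ≤ (2 * δb) ^ (k + 1) :=
            pow_le_pow_left₀ (by positivity) (by linarith) _
          have h0 : 0 ≤ srwI D (n + 1) 0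
              (fun μ : Fin D => if (μ : ℕ) < k + 1 then ((((c.J + 1) * M - c.amax : ℕ)) : ℤ) else 0) :=
            srwI_nonneg (d := D) (n + 1) hD 0 _
          exact mul_le_mul (mul_le_mul_of_nonneg_left h1 (Nat.cast_nonneg _)) (hIk k hk) h0
            (by positivity)
      _ = ((1 + 2 * δb) ^ D - 1) * Ifar := by
          rw [← Finset.sum_mul, sum_choose_succ_mul_pow_succ]
  -- the second term (identical to the single-row one)
  have hα : ∑ j ∈ Finset.range (c.J + 1), (if j = 0 then (1 : ℝ) else 2) * ‖c.toTwCert.cT j‖ = 2 * π * A :=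
    c.toTwCert.sum_weight_norm_cT hq
  have hη : η ≤ (2 * c.J + 1) * (2 * π * e) := by
    calc η ≤ ∑ j ∈ Finset.range (c.J + 1), (if j = 0 then (1 : ℝ) else 2) * (2 * π * e) := by
          refine Finset.sum_le_sum fun j hj => mul_le_mul_of_nonneg_left ?_ (hw j)
          have h := Literature.Analysis.FunctionSpaces.JLit.norm_coeff_sub_coeff_le j (he j hj)
          simpa only [TwCert.cT] using h
      _ = (2 * c.J + 1) * (2 * π * e) := by rw [← Finset.sum_mul, sum_rowWeight_eq]
  have hT2 : ((∑ j ∈ Finset.range (c.J + 1), (if j = 0 then (1 : ℝ) else 2) * ‖c.toTwCert.cT j‖ + η) ^ D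
        - (∑ j ∈ Finset.range (c.J + 1), (if j = 0 then (1 : ℝ) else 2) * ‖c.toTwCert.cT j‖) ^ D)
          / (2 * π) ^ D * I₀
        ≤ ((A + (2 * c.J + 1) * e) ^ D - A ^ D) * I0 := by
    rw [hα]
    have h1 : (2 * π * A + η) ^ D ≤ (2 * π * A + (2 * c.J + 1) * (2 * π * e)) ^ D :=
      pow_le_pow_left₀ (by positivity) (by linarith) D
    have h2 : (2 * π * A + (2 * c.J + 1) * (2 * π * e)) ^ D = (2 * π) ^ D * (A + (2 * c.J + 1) * e) ^ D := by
      rw [← mul_pow]; ring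
    have h3 : (2 * π * A) ^ D = (2 * π) ^ D * A ^ D := mul_pow _ _ _
    have hnum : (2 * π * A + η) ^ D - (2 * π * A) ^ D
        ≤ ((A + (2 * c.J + 1) * e) ^ D - A ^ D) * (2 * π) ^ D := by
      rw [sub_mul, mul_comm ((A + (2 * c.J + 1) * e) ^ D), mul_comm (A ^ D), ← h2, ← h3]
      linarith
    have hfrac : ((2 * π * A + η) ^ D - (2 * π * A) ^ D) / (2 * π) ^ D
        ≤ (A + (2 * c.J + 1) * e) ^ D - A ^ D :=
      (div_le_iff₀ (pow_pos h2π D)).2 hnum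
    have hfrac0 : 0 ≤ ((2 * π * A + η) ^ D - (2 * π * A) ^ D) / (2 * π) ^ D :=
      div_nonneg (sub_nonneg.2 (pow_le_pow_left₀ (by positivity) (by linarith) D)) (pow_nonneg h2π.le D)
    exact mul_le_mul hfrac hI0 hI₀0 (hfrac0.trans hfrac)
  -- assemble
  have key := add_le_add hT1 hT2
  calc c.truncErrP D n β M
      = (∑ k ∈ Finset.range D, (D.choose (k + 1) : ℝ) * (2 * δ) ^ (k + 1)
          * srwI D (n + 1) 0
            (fun μ : Fin D => if (μ : ℕ) < k + 1 then ((((c.J + 1) * M - c.amax : ℕ)) : ℤ) else 0))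
        + ((∑ j ∈ Finset.range (c.J + 1), (if j = 0 then (1 : ℝ) else 2) * ‖c.toTwCert.cT j‖ + η) ^ D
            - (∑ j ∈ Finset.range (c.J + 1), (if j = 0 then (1 : ℝ) else 2) * ‖c.toTwCert.cT j‖) ^ D)
              / (2 * π) ^ D * I₀ := by
        rw [truncErrP]
    _ ≤ ((1 + 2 * δb) ^ D - 1) * Ifar + ((A + (2 * c.J + 1) * e) ^ D - A ^ D) * I0 := key

/-- **Far-seed form, rational inputs:** `truncErrP c D n β M ≤ ((truncErrFarQ c.toTwCert D δ̄ e I_far I₀ : ℚ) : ℝ)` —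
the shape consumed by a kernel-decided literal inequality (product rows at the axis nodes `|m| ≥ 2` with a short
certificate row; `I_far` from a decided far-node / I-table bound via `TwCert.srwI_axisSeed_anti`).
[cite: FitznerVanDerHofstad2016NoBLE, §5.1.1 (5.2)–(5.5) pp. 1089–1090] -/
theorem truncErrP_le_far_cast (n : ℕ) (hD : 2 * (n + 1) + 1 ≤ D) (hq : 0 < c.qden) (β : ℝ) (M : ℕ)
    {δb e Ifar I0 : ℚ}
    (hδ : ∑' l : ℕ, |besselJ (l + c.J + 1) (β / D)| ≤ (δb : ℝ))
    (he : ∀ j ∈ Finset.range (c.J + 1), |((c.Q j : ℤ) : ℝ) / (c.qden : ℝ) - besselJ j (β / D)| ≤ (e : ℝ))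
    (hIfar : srwI D (n + 1) 0
        (fun μ : Fin D => if (μ : ℕ) < 1 then ((((c.J + 1) * M - c.amax : ℕ)) : ℤ) else 0) ≤ (Ifar : ℝ))
    (hI0 : srwI D (n + 1) 0 (fun _ : Fin D => 0) ≤ (I0 : ℝ)) :
    c.truncErrP D n β M ≤ ((c.toTwCert.truncErrFarQ D δb e Ifar I0 : ℚ) : ℝ) := by
  rw [TwCert.cast_truncErrFarQ]
  exact c.truncErrP_le_far D n hD hq β M hδ he hIfar hI0

/-- **Certified bracket with the far-seed literal error.** If `c.checkP D` passes, then for every exponent vector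
`a` unrolling the class list, `n ≤ 3` with `2(n+1)+1 ≤ D`, axis `i`, `β`, provided `c.amax ≤ (c.J+1)·c.m`, and
rational scalars `δ̄, e, I_far, I₀` dominating the Bessel-`J` order tail, the literal weight errors, the axis error
seed `I_{n+1,0}(((J+1)·m − a_max)·e_0)` and the origin seed:
`lo (n+1) − truncErrFarQ ≤ Tw^{Π_μ cos^{a_μ}}_{n+1}(c.m · e_i; β) ≤ hi (n+1) + truncErrFarQ`.
[cite: FitznerVanDerHofstad2016NoBLE, §5.1.1 (5.2)–(5.5) pp. 1089–1090] -/
theorem srwTwistProdCosPow_mem_of_checkP_far (h : c.checkP D = true) (a : Fin D → ℕ)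
    (ha : List.ofFn a = unroll c.cls) (n : ℕ) (hn : n ≤ 3) (hd : 2 * (n + 1) + 1 ≤ D) (i : Fin D)
    (β : ℝ) (hamax : c.amax ≤ (c.J + 1) * c.m) {δb e Ifar I0 : ℚ}
    (hδ : ∑' l : ℕ, |besselJ (l + c.J + 1) (β / D)| ≤ (δb : ℝ))
    (he : ∀ j ∈ Finset.range (c.J + 1), |((c.Q j : ℤ) : ℝ) / (c.qden : ℝ) - besselJ j (β / D)| ≤ (e : ℝ))
    (hIfar : srwI D (n + 1) 0
        (fun μ : Fin D => if (μ : ℕ) < 1 then ((((c.J + 1) * c.m - c.amax : ℕ)) : ℤ) else 0) ≤ (Ifar : ℝ))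
    (hI0 : srwI D (n + 1) 0 (fun _ : Fin D => 0) ≤ (I0 : ℝ)) :
    ((c.lo (n + 1) : ℚ) : ℝ) - ((c.toTwCert.truncErrFarQ D δb e Ifar I0 : ℚ) : ℝ)
        ≤ srwTwist D (n + 1) (fun k => ∏ μ, Real.cos (k μ) ^ a μ) (Pi.single i (c.m : ℤ)) β ∧
    srwTwist D (n + 1) (fun k => ∏ μ, Real.cos (k μ) ^ a μ) (Pi.single i (c.m : ℤ)) β
        ≤ ((c.hi (n + 1) : ℚ) : ℝ) + ((c.toTwCert.truncErrFarQ D δb e Ifar I0 : ℚ) : ℝ) := by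
  obtain ⟨h1, -, -, -, -⟩ := c.checkP_spec D h
  have hq : 0 < c.qden := (c.paramsP_of_paramsOKP D h1).toT.qden_pos
  have hE := c.truncErrP_le_far_cast D n hd hq β c.m hδ he hIfar hI0
  obtain ⟨hl, hr⟩ := c.srwTwistProdCosPow_mem_of_checkP D h a ha n hn hd i β c.m le_rfl hamax
  constructor <;> linarith

/-- **ORDER-FREE certified bracket with the far-seed literal error** (`srwTwistProdCosPow_mem_of_checkP_far`
transported along `srwTwist_prodCosPow_eq_of_ofFn_perm`): for every rearrangement `b` of the unrolled class list,
`lo (n+1) − truncErrFarQ ≤ Tw^{Π_μ cos^{b_μ}}_{n+1}(c.m · e_i; β) ≤ hi (n+1) + truncErrFarQ`.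
[cite: FitznerVanDerHofstad2016NoBLE, §5.1.1 (5.2)–(5.5) pp. 1089–1090] -/
theorem srwTwistProdCosPow_mem_of_checkP_far_perm (h : c.checkP D = true) (b : Fin D → ℕ)
    (hb : (List.ofFn b).Perm (unroll c.cls)) (n : ℕ) (hn : n ≤ 3) (hd : 2 * (n + 1) + 1 ≤ D) (i : Fin D)
    (β : ℝ) (hamax : c.amax ≤ (c.J + 1) * c.m) {δb e Ifar I0 : ℚ}
    (hδ : ∑' l : ℕ, |besselJ (l + c.J + 1) (β / D)| ≤ (δb : ℝ))
    (he : ∀ j ∈ Finset.range (c.J + 1), |((c.Q j : ℤ) : ℝ) / (c.qden : ℝ) - besselJ j (β / D)| ≤ (e : ℝ))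
    (hIfar : srwI D (n + 1) 0
        (fun μ : Fin D => if (μ : ℕ) < 1 then ((((c.J + 1) * c.m - c.amax : ℕ)) : ℤ) else 0) ≤ (Ifar : ℝ))
    (hI0 : srwI D (n + 1) 0 (fun _ : Fin D => 0) ≤ (I0 : ℝ)) :
    ((c.lo (n + 1) : ℚ) : ℝ) - ((c.toTwCert.truncErrFarQ D δb e Ifar I0 : ℚ) : ℝ)
        ≤ srwTwist D (n + 1) (fun k => ∏ μ, Real.cos (k μ) ^ b μ) (Pi.single i (c.m : ℤ)) β ∧
    srwTwist D (n + 1) (fun k => ∏ μ, Real.cos (k μ) ^ b μ) (Pi.single i (c.m : ℤ)) β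
        ≤ ((c.hi (n + 1) : ℚ) : ℝ) + ((c.toTwCert.truncErrFarQ D δb e Ifar I0 : ℚ) : ℝ) := by
  obtain ⟨a, ha, hab⟩ := exists_ofFn_eq_of_ofFn_perm D b hb
  rw [srwTwist_prodCosPow_eq_of_ofFn_perm b a hab]
  exact c.srwTwistProdCosPow_mem_of_checkP_far D h a ha n hn hd i β hamax hδ he hIfar hI0

end PrCert

end Literature.Probability.FitznerVanDerHofstad2017.SeedCert
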